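import Summits.NavierStokesRegularity.NavierStokesRegularity.Theorems.LerayQuarterDissipationFiniteDissipationLiouvilleCalmSliceForward
import Summits.NavierStokesRegularity.NavierStokesRegularity.Theorems.LerayQuarterDissipationFiniteDissipationLiouvilleCalmSliceScaling
import Summits.NavierStokesRegularity.NavierStokesRegularity.Theorems.LerayQuarterDissipationFiniteDissipationLiouvilleCalmSliceWeak
import HarnessLib

/-!
# Crux `FiniteDissipationLiouville` (stmt-NavierStokesRegularity-22144), calm-slice leaf, IV:
# ONE CALM SLICE ⇒ REGULAR APEX (the content of `CalmSliceGate.OneCalmSlice`)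

Theorems file of route `LerayQuarterDissipation` (seat ns-lqd-p2 g4; `--supports` the crux; brick
4/4 of the CALM-SLICE LEAF). It proves, for every Type-I constant `C` and dissipation constant
`K`, the existence of `δ > 0`, `R > 0` such that every member `w` of the finite-dissipation stratum
`𝒟_{C,K}` (Type-I ancient mild, KNSS gauge, `∫‖∇w(s)‖² ≤ K/√(−s)`) with ONE `(δ, R)`-calm slice
— a time `t < 0` with unsteadiness `‖√(−t)((−t)∂ₜw − ½w − ½(x·∇)w)‖ ≤ δ` on `B(0, R√(−t))` — is
bounded on some backward parabolic cylinder at the origin (`calmSlice_leaf`; verbatim the body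
of `Summit.NavierStokesRegularity.NavierStokesRegularity.Theses.CalmSliceGate.OneCalmSlice`,
item stmt-NavierStokesRegularity-24375 of the sister route `CalmSliceGate`, an alternative
decomposition of this crux). Navier–Stokes regularity is NOT proved here; no summit is: the leaf
removes the CALM members of `𝒟` from the open obligation, whose residue is perpetual flicker.

Proof (compactness–rigidity, the Chae–Wolf-style sibling of Pineau–Vicol 2026 Thm 1.9 inside `𝒟`,
with neither envelope nor pressure hypothesis): if not, there are singular members `w_k ∈ 𝒟_{C,K}`
with `(1/(k+1), k+1)`-calm slices `t_k`; rescale `t_k` to `−1` (bricks II: class, law, singularity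
and unsteadiness are scale invariant); KNSS compactness ACROSS members (`Compactness.seqLimit`)
gives a limit `W ∈ 𝒟_{C,K}` (`law_of_seqLimit`), SINGULAR (`persistent_singularity_seq`), whose
slice `−1` has vanishing weak unsteadiness (`tendsto_weakUnsteadiness`: the functional is
derivative-free in the slice, so pointwise convergence and the Type-I bound suffice — dominated
convergence); by brick III (de Rham + Leray's profile system + Tsai's `L⁶` Liouville theorem)
`W(−1) = 0`, and by brick I (forward uniqueness) `W` is not singular — contradiction.

References: Pineau–Vicol, arXiv:2607.09619 Thm 1.9; Tsai, ARMA 143 (1998) Thm 1; KNSS,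
arXiv:0709.3599 §4; Chae–Wolf, arXiv:1610.09464 (compactness–rigidity pattern).
-/

noncomputable section

-- the summit and its single sub-problem share the name (CONVENTIONS §1), as in every Theorems file
set_option linter.dupNamespace false

namespace Summit.NavierStokesRegularity.NavierStokesRegularity.Theorems.FiniteDissipationLiouville.CalmSlice

open MeasureTheory Set Filter Topology Metric Function TopologicalSpace InnerProductSpace
open Literature.Analysis Literature.Analysis.FluidPDE
open scoped ENNReal NNReal RealInnerProductSpace Laplacian ContDiff

/-! ### The weak unsteadiness passes to pointwise limits -/

/-- **The weak unsteadiness functional is continuous along pointwise limits in the class.** If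
`v j` are Type-I ancient mild with a common constant `C` and `v j (−1, y) → W(−1, y)` for every
`y`, then for `ψ ∈ C²_c` the derivative-free functionals
`∫ (⟪Vⱼ,(Vⱼ·∇)ψ⟫ + ⟪Vⱼ,Δψ⟫ + ⟪Vⱼ,ψ⟫ + ½⟪Vⱼ,(y·∇)ψ⟫)`, `Vⱼ = v j(−1,·)`, converge to that of
`W(−1,·)` (dominated convergence with the Type-I bound `‖Vⱼ‖ ≤ C`). [cite: KochNadirashviliSereginSverak2009, §4 (arXiv:0709.3599 p. 8)] -/
theorem tendsto_weakUnsteadiness {C : ℝ}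
    {v : ℕ → ℝ → EuclideanSpace ℝ (Fin 3) → EuclideanSpace ℝ (Fin 3)}
    {W : ℝ → EuclideanSpace ℝ (Fin 3) → EuclideanSpace ℝ (Fin 3)}
    (hv : ∀ j, IsTypeIAncientMild C (v j))
    (hpt : ∀ y, Tendsto (fun j => v j (-1) y) atTop (𝓝 (W (-1) y)))
    {ψ : EuclideanSpace ℝ (Fin 3) → EuclideanSpace ℝ (Fin 3)}
    (hψ : ContDiff ℝ 2 ψ) (hc : HasCompactSupport ψ) :
    Tendsto (fun j => ∫ y, (⟪v j (-1) y, convect (v j (-1)) ψ y⟫ + ⟪v j (-1) y, (Δ ψ) y⟫ +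
        ⟪v j (-1) y, ψ y⟫ + (1 / 2 : ℝ) * ⟪v j (-1) y, fderiv ℝ ψ y y⟫)) atTop
      (𝓝 (∫ y, (⟪W (-1) y, convect (W (-1)) ψ y⟫ + ⟪W (-1) y, (Δ ψ) y⟫ +
        ⟪W (-1) y, ψ y⟫ + (1 / 2 : ℝ) * ⟪W (-1) y, fderiv ℝ ψ y y⟫))) := by
  have hC : 0 ≤ C := (hv 0).nonneg
  have hψ1 : ContDiff ℝ 1 ψ := hψ.of_le one_le_two
  have hDψc : Continuous (fderiv ℝ ψ) := hψ1.continuous_fderiv one_ne_zero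
  have hΔc : Continuous (Δ ψ) := continuous_laplacian hψ
  have hψc : Continuous ψ := hψ.continuous
  -- the Type-I bound at time `-1`
  have hb : ∀ j y, ‖v j (-1) y‖ ≤ C := fun j y => by
    have := (hv j).norm_le (t := -1) (by norm_num) y
    rwa [neg_neg, Real.sqrt_one, div_one] at this
  -- the dominating function
  set bound : EuclideanSpace ℝ (Fin 3) → ℝ := fun y =>
    C * (‖fderiv ℝ ψ y‖ * C) + C * ‖(Δ ψ) y‖ + C * ‖ψ y‖ +
      (1 / 2 : ℝ) * (C * (‖fderiv ℝ ψ y‖ * ‖y‖)) with hbound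
  have hcD : HasCompactSupport fun y => ‖fderiv ℝ ψ y‖ := (hc.fderiv (𝕜 := ℝ)).norm
  have hcΔ : HasCompactSupport fun y => ‖(Δ ψ) y‖ :=
    (hc.mono' fun y hy => by
      contrapose! hy; simp [laplacian_eq_zero_of_notMem_tsupport hy] : HasCompactSupport (Δ ψ)).norm
  have hbi : Integrable bound volume := by
    refine (((?_ : Integrable _ volume).add ?_).add ?_).add ?_
    · exact ((hDψc.norm.mul continuous_const).integrable_of_hasCompactSupport
        (hcD.mul_right)).const_mul C
    · exact (hΔc.norm.integrable_of_hasCompactSupport hcΔ).const_mul C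
    · exact (hψc.norm.integrable_of_hasCompactSupport hc.norm).const_mul C
    · exact (((hDψc.norm.mul continuous_norm).integrable_of_hasCompactSupport
        (hcD.mul_right)).const_mul C).const_mul _
  refine tendsto_integral_of_dominated_convergence bound (fun j => ?_) hbi (fun j => ?_) ?_
  · -- measurability: the integrand is continuous
    have hvc : Continuous (v j (-1)) := (hv j).continuous_slice (by norm_num)
    have c1 : Continuous fun y => ⟪v j (-1) y, convect (v j (-1)) ψ y⟫ :=
      hvc.inner (hDψc.clm_apply hvc)
    have c2 : Continuous fun y => ⟪v j (-1) y, (Δ ψ) y⟫ := hvc.inner hΔc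
    have c3 : Continuous fun y => ⟪v j (-1) y, ψ y⟫ := hvc.inner hψc
    have c4 : Continuous fun y => (1 / 2 : ℝ) * ⟪v j (-1) y, fderiv ℝ ψ y y⟫ :=
      continuous_const.mul (hvc.inner (hDψc.clm_apply continuous_id))
    exact (((c1.add c2).add c3).add c4).aestronglyMeasurable
  · -- domination
    refine Eventually.of_forall fun y => ?_
    rw [Real.norm_eq_abs]
    set a : EuclideanSpace ℝ (Fin 3) := v j (-1) y with ha
    have hay : ‖a‖ ≤ C := hb j y
    set T₁ : ℝ := ⟪a, convect (v j (-1)) ψ y⟫ with hT₁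
    set T₂ : ℝ := ⟪a, (Δ ψ) y⟫ with hT₂
    set T₃ : ℝ := ⟪a, ψ y⟫ with hT₃
    set T₄ : ℝ := (1 / 2 : ℝ) * ⟪a, fderiv ℝ ψ y y⟫ with hT₄
    have h1 : |T₁| ≤ C * (‖fderiv ℝ ψ y‖ * C) := by
      rw [hT₁, convect_apply, ← ha]
      refine (abs_real_inner_le_norm _ _).trans (mul_le_mul hay ?_ (norm_nonneg _) hC)
      exact ((fderiv ℝ ψ y).le_opNorm _).trans (mul_le_mul_of_nonneg_left hay (norm_nonneg _))
    have h2 : |T₂| ≤ C * ‖(Δ ψ) y‖ :=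
      (abs_real_inner_le_norm _ _).trans (mul_le_mul_of_nonneg_right hay (norm_nonneg _))
    have h3 : |T₃| ≤ C * ‖ψ y‖ :=
      (abs_real_inner_le_norm _ _).trans (mul_le_mul_of_nonneg_right hay (norm_nonneg _))
    have h4 : |T₄| ≤ (1 / 2 : ℝ) * (C * (‖fderiv ℝ ψ y‖ * ‖y‖)) := by
      rw [hT₄, abs_mul, abs_of_pos (by norm_num : (0 : ℝ) < 1 / 2)]
      refine mul_le_mul_of_nonneg_left ?_ (by norm_num)
      exact (abs_real_inner_le_norm _ _).trans
        (mul_le_mul hay ((fderiv ℝ ψ y).le_opNorm _) (norm_nonneg _) hC)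
    have e1 : |T₁ + T₂ + T₃ + T₄| ≤ |T₁ + T₂ + T₃| + |T₄| := abs_add_le _ _
    have e2 : |T₁ + T₂ + T₃| ≤ |T₁ + T₂| + |T₃| := abs_add_le _ _
    have e3 : |T₁ + T₂| ≤ |T₁| + |T₂| := abs_add_le _ _
    have hb_eq : bound y = C * (‖fderiv ℝ ψ y‖ * C) + C * ‖(Δ ψ) y‖ + C * ‖ψ y‖ +
        (1 / 2 : ℝ) * (C * (‖fderiv ℝ ψ y‖ * ‖y‖)) := rfl
    rw [hb_eq]
    linarith
  · -- pointwise convergence: the integrand is continuous in the value of the slice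
    refine Eventually.of_forall fun y => ?_
    have hF : Continuous fun a : EuclideanSpace ℝ (Fin 3) =>
        ⟪a, fderiv ℝ ψ y a⟫ + ⟪a, (Δ ψ) y⟫ + ⟪a, ψ y⟫ + (1 / 2 : ℝ) * ⟪a, fderiv ℝ ψ y y⟫ :=
      (((continuous_id.inner (fderiv ℝ ψ y).continuous).add (continuous_id.inner
        continuous_const)).add (continuous_id.inner continuous_const)).add
        (continuous_const.mul (continuous_id.inner continuous_const))
    simpa only [convect_apply, Function.comp_def] using (hF.tendsto (W (-1) y)).comp (hpt y)

/-! ### One calm slice ⇒ regular apex -/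

/-- **ONE CALM SLICE ⇒ REGULAR APEX** (the calm-slice leaf of `FiniteDissipationLiouville`;
verbatim the body of `Theses.CalmSliceGate.OneCalmSlice`, stmt-NavierStokesRegularity-24375).
For all `C`, `K` there are `δ > 0` and `R > 0` such that every Type-I ancient mild field `w`
(constant `C`) with the finite-dissipation law (constant `K`) possessing ONE slice `t < 0` whose
unsteadiness `‖√(−t)((−t)∂ₜw − ½w − ½(x·∇)w)‖` is `≤ δ` on `B(0, R√(−t))` is bounded on some
backward parabolic cylinder at the origin. Proof: contradiction sequence, rescaling of the calm
slices to `−1`, KNSS compactness across members + persistence of the singularity + the law of the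
limit, vanishing of the (derivative-free) weak unsteadiness of the limit slice, de Rham + Leray's
profile system + Tsai's `L⁶` Liouville theorem, forward uniqueness. [cite: Tsai1998, Theorem 1 (p. 31)] -/
theorem calmSlice_leaf : ∀ (C K : ℝ), ∃ δ > 0, ∃ R > 0,
    ∀ (w : ℝ → EuclideanSpace ℝ (Fin 3) → EuclideanSpace ℝ (Fin 3)),
      Literature.Analysis.FluidPDE.IsTypeIAncientMild C w →
      (∀ s : ℝ, s < 0 → ∫⁻ x, ‖fderiv ℝ (w s) x‖ₑ ^ 2 ≤ ENNReal.ofReal (K / Real.sqrt (-s))) →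
      (∃ t < 0, ∀ x ∈ Metric.ball (0 : EuclideanSpace ℝ (Fin 3)) (R * Real.sqrt (-t)),
        ‖Real.sqrt (-t) • ((-t) • deriv (fun τ => w τ x) t - (1 / 2 : ℝ) • w t x -
          (1 / 2 : ℝ) • fderiv ℝ (w t) x x)‖ ≤ δ) →
      ¬ (∀ r > 0, ∀ M : ℝ, ∃ t ∈ Set.Ioo (-(r ^ 2)) (0 : ℝ),
        ∃ x ∈ Metric.ball (0 : EuclideanSpace ℝ (Fin 3)) r, M < ‖w t x‖) := by
  intro C K
  by_contra hcon
  push Not at hcon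
  -- ## a contradiction sequence, calm slices rescaled to `-1`
  have hk : ∀ k : ℕ, ∃ v : ℝ → EuclideanSpace ℝ (Fin 3) → EuclideanSpace ℝ (Fin 3),
      IsTypeIAncientMild C v ∧
      (∀ s : ℝ, s < 0 → ∫⁻ x, ‖fderiv ℝ (v s) x‖ₑ ^ 2 ≤ ENNReal.ofReal (K / Real.sqrt (-s))) ∧
      (∀ r > 0, ∀ M : ℝ, ∃ t ∈ Ioo (-(r ^ 2)) (0 : ℝ),
        ∃ x ∈ ball (0 : EuclideanSpace ℝ (Fin 3)) r, M < ‖v t x‖) ∧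
      (∀ y ∈ ball (0 : EuclideanSpace ℝ (Fin 3)) ((k : ℝ) + 1),
        ‖deriv (fun τ => v τ y) (-1) - (1 / 2 : ℝ) • v (-1) y -
          (1 / 2 : ℝ) • fderiv ℝ (v (-1)) y y‖ ≤ 1 / ((k : ℝ) + 1)) := by
    intro k
    obtain ⟨w, hw, hlaw, ⟨t, ht, hcalm⟩, hsing⟩ :=
      hcon (1 / ((k : ℝ) + 1)) (by positivity) ((k : ℝ) + 1) (by positivity)
    have hμ : 0 < Real.sqrt (-t) := Real.sqrt_pos.2 (neg_pos.2 ht)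
    exact ⟨nsRescale (Real.sqrt (-t)) w, isTypeIAncientMild_nsRescale hw hμ,
      RecurrentReductionD.dissipationLaw_nsRescale hlaw hμ,
      RecurrentReductionD.singularAtOrigin_nsRescale hsing hμ, calm_nsRescale hw ht hcalm⟩
  choose v hv hlaw hsing hcalm using hk
  -- ## compactness across members, law of the limit, persistence of the singularity
  obtain ⟨φ, hφ, W, hW, hunif, hpt, hgrad⟩ := Compactness.seqLimit hv
  have hWlaw : ∀ s : ℝ, s < 0 →
      ∫⁻ x, ‖fderiv ℝ (W s) x‖ₑ ^ 2 ≤ ENNReal.ofReal (K / Real.sqrt (-s)) :=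
    Compactness.law_of_seqLimit (Kk := fun _ => K) (Kinf := K) hφ.tendsto_atTop hlaw
      (fun ε hε => Eventually.of_forall fun k => by linarith) hgrad
  have hWsing := Compactness.persistent_singularity_seq (w := fun j => v (φ j))
    (fun j => hv _) (fun j => hlaw _) (fun j => hsing _) hW hunif
  -- ## the weak unsteadiness of the limit slice `-1` vanishes
  have hweak : ∀ ψ : EuclideanSpace ℝ (Fin 3) → EuclideanSpace ℝ (Fin 3), ContDiff ℝ ∞ ψ →
      HasCompactSupport ψ → VectorCalculus.IsDivFree ψ →
      ∫ y, (⟪W (-1) y, convect (W (-1)) ψ y⟫ + ⟪W (-1) y, (Δ ψ) y⟫ + ⟪W (-1) y, ψ y⟫ +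
        (1 / 2 : ℝ) * ⟪W (-1) y, fderiv ℝ ψ y y⟫) = 0 := by
    intro ψ hψ hcψ hdiv
    have hψ2 : ContDiff ℝ 2 ψ := contDiff_infty.1 hψ 2
    have hlim := tendsto_weakUnsteadiness (v := fun j => v (φ j)) (W := W) (fun j => hv _)
      (hpt (-1) (by norm_num)) hψ2 hcψ
    -- the support of `ψ` lies in some ball `B(0, ρ)`
    obtain ⟨ρ, hρ⟩ : ∃ ρ : ℝ, tsupport ψ ⊆ ball (0 : EuclideanSpace ℝ (Fin 3)) ρ :=
      (hcψ.isCompact.isBounded).subset_ball 0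
    -- along the sequence the functional is `≤ ‖ψ‖₁/(φ j + 1)` eventually, hence `→ 0`
    have hsmall : ∀ᶠ j in atTop, ‖∫ y, (⟪v (φ j) (-1) y, convect (v (φ j) (-1)) ψ y⟫ +
        ⟪v (φ j) (-1) y, (Δ ψ) y⟫ + ⟪v (φ j) (-1) y, ψ y⟫ +
        (1 / 2 : ℝ) * ⟪v (φ j) (-1) y, fderiv ℝ ψ y y⟫)‖ ≤
        (1 / (((φ j : ℕ) : ℝ) + 1)) * ∫ y, ‖ψ y‖ := by
      have hev : ∀ᶠ j in atTop, ρ ≤ ((φ j : ℕ) : ℝ) + 1 := by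
        have h1 : Tendsto (fun j => ((φ j : ℕ) : ℝ) + 1) atTop atTop :=
          tendsto_atTop_add_const_right _ 1
            (tendsto_natCast_atTop_atTop.comp hφ.tendsto_atTop)
        exact h1.eventually_ge_atTop ρ
      filter_upwards [hev] with j hj
      rw [Real.norm_eq_abs]
      exact abs_weakUnsteadiness_le_of_calm (hv _) (hcalm (φ j)) hψ2 hcψ hdiv
        (hρ.trans (ball_subset_ball hj))
    have hzero : Tendsto (fun j => ∫ y, (⟪v (φ j) (-1) y, convect (v (φ j) (-1)) ψ y⟫ +
        ⟪v (φ j) (-1) y, (Δ ψ) y⟫ + ⟪v (φ j) (-1) y, ψ y⟫ +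
        (1 / 2 : ℝ) * ⟪v (φ j) (-1) y, fderiv ℝ ψ y y⟫)) atTop (𝓝 0) := by
      refine squeeze_zero_norm' hsmall ?_
      have h0 : Tendsto (fun j => 1 / (((φ j : ℕ) : ℝ) + 1)) atTop (𝓝 0) :=
        tendsto_one_div_add_atTop_nhds_zero_nat.comp hφ.tendsto_atTop
      simpa using h0.mul_const (∫ y, ‖ψ y‖)
    exact tendsto_nhds_unique hlim hzero
  -- ## the limit slice vanishes; forward uniqueness contradicts persistence
  have hW0 : ∀ x, W (-1) x = 0 := slice_eq_zero_of_weakUnsteadiness_eq_zero hW hWlaw hweak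
  exact not_singular_of_zero_slice hW (by norm_num) hW0 hWsing

end Summit.NavierStokesRegularity.NavierStokesRegularity.Theorems.FiniteDissipationLiouville.CalmSlice

end
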